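import Mathlib
import Literature.Analysis.FluidPDE.EulerReynoldsLadderGluingIBP
import HarnessLib

/-!
# Ladder gluing of steady Euler–Reynolds subsolutions, II: matching across the sphere
# without traces

Analysis/FluidPDE support file (everything proved; no definitions, no named facts). Second of the
`EulerReynoldsLadderGluing*` files (tool T8 of the free-space sink completion, route PointSink of
the anomalous-dissipation summit, stub `stub_freeSpaceSinkCompletion`, crux
stmt-AnomalousDissipation-19035). THE SETTING. Inside the ball `|x| < r₀` sits a rough stress
`Q₀` (in the application `Q₀ = V ⊗ V` for an `L²_loc` weak Euler cone `V`); outside, on the open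
exterior `Ω = {r₀ < |x|}`, sits a glued stress `M` with `C¹` entries and `div M = 0` classically
(the mollifier ladder: smooth layers glued by partitions of unity and compactly supported
correctors), whose "recorded part" `Q = M - p·Id` (`p` an arbitrary scalar, the unrecorded
pressure) is locally integrable UP TO the sphere and equals `Q₀` inside the ball. The layers
`(S_N, P_N)` are `C¹` with `div (S_N + P_N·Id) = 0` on `{d_N < |x|}`, `d_N → 0`, they converge to
`Q₀` in `L¹_loc(ℝ³ ∖ 0)`, and — the ladder's design — `M` COINCIDES with `S_N + P_N·Id` on a shell
`s_N < |x| < s'_N` of the pure layer `N`, with `r₀ < s_N`, `s'_N → r₀`.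

* `integral_sum_sum_mul_fderiv_apply_eq_zero_of_ladder` — **matching across the sphere**: under
  these hypotheses `∫ Σᵢⱼ Qᵢⱼ (Dw eⱼ)ᵢ = 0` for every smooth divergence-free `w` compactly
  supported in `ℝ³ ∖ {0}`; i.e. the glued pair is a weak (linear) Euler–Reynolds subsolution
  across `|x| = r₀` although nothing is known about traces of `Q₀` on spheres.
* `integral_eulerReynolds_eq_zero_of_ladder` — the same in the summit's format
  `∫ (⟪U, Dw·U⟫ + Σᵢⱼ Rᵢⱼ (Dw eⱼ)ᵢ) = 0` for `Q = U ⊗ U + R`, `Q₀ = V ⊗ V`, `U = V` and `R = 0`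
  inside the ball, `|U|², |V|² ∈ L¹_loc`, `R ∈ L¹_loc` (clause 10 of the stub, given the ladder).

THE ARGUMENT (no traces, no Lebesgue points of `ρ ↦ ∫_{S_ρ}|V|²`). Fix `w` and `η > 0`; choose a
thin shell `T = {r₀ ≤ |x| < t}` with `∫_T Σ|Q - Q₀| < η` (absolute continuity: the shells shrink
to the null sphere), then `N` with `d_N` below the support of `w`, `s'_N < t` and
`∫_{supp-shell} Σ|S_N - Q₀| < η`, and a radial cut-off `χ = 1 - ψ` across `s_N < |x| < s'_N`
(`EulerReynoldsLadderGluingIBP.exists_radial_cutoff`). Since `M` and `S_N + P_N·Id` are both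
divergence free near the relevant supports and agree where `∇χ ≠ 0`,
`∫ χ Q:∇w = ∫ χ M:∇w = ∫ χ (S_N + P_N Id):∇w = ∫ χ S_N:∇w` (isotropic parts pair to
`p div w = 0` pointwise), while `∫ S_N:∇w = ∫ (S_N + P_N Id):∇w = 0`; hence
`∫ Q:∇w = ∫ ψ (Q - S_N):∇w`, which is bounded by `‖∇w‖_∞ (∫_T Σ|Q - Q₀| + ∫ Σ|S_N - Q₀|) < 2‖∇w‖_∞ η`
because `Q = Q₀` inside the ball and `ψ` lives in `|x| < s'_N < t`.

## Mathlib / tree search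

Mathlib: `tendsto_setIntegral_of_antitone`, `Measure.addHaar_sphere`,
`norm_integral_le_of_norm_le`, `LocallyIntegrable.integrable_smul_right_of_hasCompactSupport`.
Tree: part I (`EulerReynoldsLadderGluingIBP`), `MollifiedEulerCone.sum_sum_mul_mul_apply_single`,
`sum_sum_ite_mul_fderiv_apply_eq` (`EulerReynoldsLocalization`). No sphere-matching / gluing
lemma for weak Euler–Reynolds pairs exists (`lean search 'Ladder|gluing|EulerReynolds'`,
2026-08-17).

## References

* C. De Lellis, L. Székelyhidi Jr., Arch. Ration. Mech. Anal. 195 (2010) 225–260, §2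
  (subsolutions and their gluing). [DeLellisSzekelyhidi2010]
* G. P. Galdi, *An Introduction to the Mathematical Theory of the Navier–Stokes Equations*
  (2011), §III.4. [Galdi2011]
-/

noncomputable section

open MeasureTheory Filter Topology Set Metric Function
open scoped RealInnerProductSpace ContDiff

namespace Literature.Analysis.FluidPDE

namespace EulerReynoldsLadder

/-- Closed spherical shells are compact. [folklore] -/
theorem isCompact_shell (a b : ℝ) :
    IsCompact {x : EuclideanSpace ℝ (Fin 3) | a ≤ ‖x‖ ∧ ‖x‖ ≤ b} :=
  (isCompact_closedBall (0 : EuclideanSpace ℝ (Fin 3)) b).of_isClosed_subset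
    ((isClosed_le continuous_const continuous_norm).inter
      (isClosed_le continuous_norm continuous_const))
    fun _ hx => mem_closedBall_zero_iff.2 hx.2

/-- A closed shell `a ≤ |x| ≤ b` with `0 < a` avoids the origin. [folklore] -/
theorem shell_subset_ne_zero {a : ℝ} (ha : 0 < a) (b : ℝ) :
    {x : EuclideanSpace ℝ (Fin 3) | a ≤ ‖x‖ ∧ ‖x‖ ≤ b} ⊆ {x | x ≠ 0} := by
  intro x hx h0
  rw [mem_setOf_eq, h0, norm_zero] at hx
  linarith [hx.1]

/-- **Matching across the sphere without traces (stress form).** See the module docstring for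
the setting and the argument. Hypotheses: `Q` locally integrable on `ℝ³` (entrywise), `Q₀`
locally integrable off the origin, `Q = Q₀` on the open ball `|x| < r₀`; a glued stress `M`
with `C¹` entries and zero row-divergence on `{r₀ < |x|}`, `M = Q + p·Id` there; layers
`(S_N, P_N)`, `C¹` with `Σⱼ ∂ⱼ(S_N)ᵢⱼ + ∂ᵢP_N = 0` on `{d_N < |x|}`, `r₀ < s_N < s'_N`,
`d_N → 0`, `s'_N → r₀`, `M = S_N + P_N·Id` on `s_N < |x| < s'_N`, and
`∫_{a<|x|<b} Σᵢⱼ |S_N - Q₀| → 0` for all `0 < a < b`. Conclusion: `∫ Σᵢⱼ Qᵢⱼ (Dw eⱼ)ᵢ = 0` for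
every smooth divergence-free `w` compactly supported in `ℝ³ ∖ {0}`. [folklore] -/
theorem integral_sum_sum_mul_fderiv_apply_eq_zero_of_ladder {r₀ : ℝ} (hr₀ : 0 < r₀)
    {Q Q₀ M : EuclideanSpace ℝ (Fin 3) → Fin 3 → Fin 3 → ℝ} {p : EuclideanSpace ℝ (Fin 3) → ℝ}
    (hQ : ∀ i j, LocallyIntegrable (fun x => Q x i j) volume)
    (hQ₀ : ∀ i j, LocallyIntegrableOn (fun x => Q₀ x i j) {x | x ≠ 0} volume)
    (hQQ₀ : ∀ x, ‖x‖ < r₀ → Q x = Q₀ x)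
    (hM : ∀ i j, ContDiffOn ℝ 1 (fun x => M x i j) {x | r₀ < ‖x‖})
    (hMdiv : ∀ x : EuclideanSpace ℝ (Fin 3), r₀ < ‖x‖ → ∀ i,
      ∑ j, fderiv ℝ (fun y => M y i j) x (EuclideanSpace.single j 1) = 0)
    (hMQ : ∀ x : EuclideanSpace ℝ (Fin 3), r₀ < ‖x‖ → ∀ i j,
      M x i j = Q x i j + if i = j then p x else 0)
    {S : ℕ → EuclideanSpace ℝ (Fin 3) → Fin 3 → Fin 3 → ℝ} {P : ℕ → EuclideanSpace ℝ (Fin 3) → ℝ}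
    {d s s' : ℕ → ℝ}
    (hS : ∀ N i j, ContDiffOn ℝ 1 (fun x => S N x i j) {x | d N < ‖x‖})
    (hP : ∀ N, ContDiffOn ℝ 1 (P N) {x | d N < ‖x‖})
    (hSP : ∀ (N : ℕ) (x : EuclideanSpace ℝ (Fin 3)), d N < ‖x‖ → ∀ i,
      ∑ j, fderiv ℝ (fun y => S N y i j) x (EuclideanSpace.single j 1) +
        fderiv ℝ (P N) x (EuclideanSpace.single i 1) = 0)
    (hrs : ∀ N, r₀ < s N) (hss' : ∀ N, s N < s' N)
    (hd : Tendsto d atTop (𝓝 0)) (hs' : Tendsto s' atTop (𝓝 r₀))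
    (hagree : ∀ (N : ℕ) (x : EuclideanSpace ℝ (Fin 3)), s N < ‖x‖ → ‖x‖ < s' N → ∀ i j,
      M x i j = S N x i j + if i = j then P N x else 0)
    (hconv : ∀ a b : ℝ, 0 < a → a < b → Tendsto (fun N =>
      ∫ x in {x : EuclideanSpace ℝ (Fin 3) | a < ‖x‖ ∧ ‖x‖ < b},
        ∑ i, ∑ j, |S N x i j - Q₀ x i j|) atTop (𝓝 0))
    {w : EuclideanSpace ℝ (Fin 3) → EuclideanSpace ℝ (Fin 3)}
    (hw : FunctionSpaces.IsTestFunctionOn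
      ⟨{x : EuclideanSpace ℝ (Fin 3) | x ≠ 0}, isOpen_ne⟩ w)
    (hwdiv : ∀ x, VectorCalculus.divergence w x = 0) :
    ∫ x, ∑ i, ∑ j, Q x i j * fderiv ℝ w x (EuclideanSpace.single j 1) i = 0 := by
  have hws : ContDiff ℝ 1 w := hw.contDiff.of_le (by exact_mod_cast le_top)
  have hwc : HasCompactSupport w := hw.hasCompactSupport
  -- Step 0: the test field lives in a shell `a < |x| < b`, `a < r₀ < r₀ + 1 ≤ b`
  obtain ⟨δ, hδ, hδw⟩ : ∃ δ > 0, ∀ x : EuclideanSpace ℝ (Fin 3), x ∈ tsupport w → δ ≤ ‖x‖ := by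
    have h0 : (0 : EuclideanSpace ℝ (Fin 3)) ∈ (tsupport w)ᶜ := fun h => hw.tsupport_subset h rfl
    obtain ⟨δ, hδ, hball⟩ := Metric.isOpen_iff.1 (isClosed_tsupport w).isOpen_compl 0 h0
    refine ⟨δ, hδ, fun x hx => ?_⟩
    by_contra h
    exact hball (mem_ball_zero_iff.2 (not_le.1 h)) hx
  obtain ⟨b₀, hb₀⟩ := hwc.isCompact.isBounded.subset_ball (0 : EuclideanSpace ℝ (Fin 3))
  set a : ℝ := min δ r₀ / 2 with ha
  have ha0 : 0 < a := by positivity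
  have haδ : a < δ := by have := min_le_left δ r₀; linarith
  have har : a < r₀ := by have := min_le_right δ r₀; linarith
  set b : ℝ := max b₀ (r₀ + 1) with hb
  have hb1 : r₀ + 1 ≤ b := le_max_right _ _
  have hab : a < b := by linarith
  have hwa : ∀ x, x ∈ tsupport w → a < ‖x‖ := fun x hx => lt_of_lt_of_le haδ (hδw x hx)
  have hwb : ∀ x, x ∈ tsupport w → ‖x‖ < b := fun x hx =>
    lt_of_lt_of_le (mem_ball_zero_iff.1 (hb₀ hx)) (le_max_left _ _)
  -- the derivative of `w`: bounded, continuous, compactly supported coordinates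
  obtain ⟨K, hK⟩ := (hw.contDiff.continuous_fderiv (by simp)).bounded_above_of_compact_support
    (hwc.fderiv (𝕜 := ℝ))
  have hK0 : 0 ≤ K := (norm_nonneg _).trans (hK 0)
  have hDw : ∀ (x : EuclideanSpace ℝ (Fin 3)) (i j : Fin 3),
      |fderiv ℝ w x (EuclideanSpace.single j 1) i| ≤ K := by
    intro x i j
    calc |fderiv ℝ w x (EuclideanSpace.single j 1) i|
        ≤ ‖fderiv ℝ w x (EuclideanSpace.single j 1)‖ := by
          simpa using PiLp.norm_apply_le (fderiv ℝ w x (EuclideanSpace.single j 1)) i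
      _ ≤ ‖fderiv ℝ w x‖ * ‖(EuclideanSpace.single j (1 : ℝ) : EuclideanSpace ℝ (Fin 3))‖ :=
          ContinuousLinearMap.le_opNorm _ _
      _ ≤ K := by
          have hn : ‖(EuclideanSpace.single j (1 : ℝ) : EuclideanSpace ℝ (Fin 3))‖ = 1 := by simp
          rw [hn, mul_one]
          exact hK x
  have hDw0 : ∀ x, x ∉ tsupport w → fderiv ℝ w x = 0 := fun x hx =>
    fderiv_of_notMem_tsupport ℝ hx
  have hwcont : ∀ i j : Fin 3, Continuous fun x => fderiv ℝ w x (EuclideanSpace.single j 1) i :=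
    fun i j => (EuclideanSpace.proj i : EuclideanSpace ℝ (Fin 3) →L[ℝ] ℝ).continuous.comp
      ((hw.contDiff.continuous_fderiv (by simp)).clm_apply continuous_const)
  have hwcs : ∀ i j : Fin 3,
      HasCompactSupport fun x => fderiv ℝ w x (EuclideanSpace.single j 1) i := fun i j =>
    (hwc.fderiv_apply (𝕜 := ℝ) (EuclideanSpace.single j 1)).comp_left
      (g := fun v : EuclideanSpace ℝ (Fin 3) => v i) rfl
  have hwts : ∀ i j : Fin 3,
      tsupport (fun x => fderiv ℝ w x (EuclideanSpace.single j 1) i) ⊆ tsupport w := fun i j =>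
    (tsupport_apply_subset _ i).trans (tsupport_fderiv_apply_subset ℝ _)
  -- the integrand `G = Q : ∇w` and the defect density `D = Σ|Q - Q₀|`
  set G : EuclideanSpace ℝ (Fin 3) → ℝ := fun x =>
    ∑ i, ∑ j, Q x i j * fderiv ℝ w x (EuclideanSpace.single j 1) i with hG
  set D : EuclideanSpace ℝ (Fin 3) → ℝ := fun x => ∑ i, ∑ j, |Q x i j - Q₀ x i j| with hD
  have hD0 : ∀ x, 0 ≤ D x := fun x =>
    Finset.sum_nonneg fun i _ => Finset.sum_nonneg fun j _ => abs_nonneg _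
  have hGint : Integrable G := by
    refine integrable_finsetSum _ fun i _ => integrable_finsetSum _ fun j _ => ?_
    have h := (hQ i j).integrable_smul_right_of_hasCompactSupport (hwcont i j) (hwcs i j)
    simpa only [smul_eq_mul] using h
  have hDint : IntegrableOn D {x : EuclideanSpace ℝ (Fin 3) | r₀ ≤ ‖x‖ ∧ ‖x‖ ≤ r₀ + 1} := by
    refine integrable_finsetSum _ fun i _ => integrable_finsetSum _ fun j _ => ?_
    exact (((hQ i j).integrableOn_isCompact (isCompact_shell r₀ (r₀ + 1))).sub
      ((hQ₀ i j).integrableOn_compact_subset (shell_subset_ne_zero hr₀ _)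
        (isCompact_shell r₀ (r₀ + 1)))).abs
  -- Step 1: thin shells at the sphere carry little `D`-mass
  set T : ℕ → Set (EuclideanSpace ℝ (Fin 3)) := fun k =>
    {x | r₀ ≤ ‖x‖ ∧ ‖x‖ < r₀ + 1 / ((k : ℝ) + 1)} with hT
  have hTm : ∀ k, MeasurableSet (T k) := fun k =>
    (measurableSet_le measurable_const measurable_norm).inter
      (measurableSet_lt measurable_norm measurable_const)
  have hTanti : Antitone T := by
    intro k l hkl x hx
    refine ⟨hx.1, lt_of_lt_of_le hx.2 ?_⟩
    have : (1 : ℝ) / ((l : ℝ) + 1) ≤ 1 / ((k : ℝ) + 1) := by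
      gcongr
    linarith
  have hT0 : T 0 ⊆ {x : EuclideanSpace ℝ (Fin 3) | r₀ ≤ ‖x‖ ∧ ‖x‖ ≤ r₀ + 1} := fun x hx =>
    ⟨hx.1, by have h := hx.2; norm_num at h; exact h.le⟩
  have hTlim : Tendsto (fun k => ∫ x in T k, D x) atTop (𝓝 0) := by
    have h := tendsto_setIntegral_of_antitone hTm hTanti ⟨0, hDint.mono_set hT0⟩
    have hnull : volume (⋂ k, T k) = 0 := by
      refine measure_mono_null ?_ (Measure.addHaar_sphere volume (0 : EuclideanSpace ℝ (Fin 3)) r₀)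
      intro x hx
      rw [mem_iInter] at hx
      rw [mem_sphere_zero_iff_norm]
      refine le_antisymm (le_of_forall_pos_lt_add fun ε hε => ?_) (hx 0).1
      obtain ⟨k, hk⟩ := exists_nat_one_div_lt hε
      linarith [(hx k).2]
    rwa [setIntegral_measure_zero _ hnull] at h
  -- Step 2: `|∫ G| ≤ 2 K η` for every `η > 0`
  have hmain : ∀ η : ℝ, 0 < η → |∫ x, G x| ≤ K * (η + η) := by
    intro η hη
    -- a thin shell with small `D`-mass
    obtain ⟨k, hk⟩ := (hTlim.eventually_lt_const hη).exists
    have hkpos : (0 : ℝ) < 1 / ((k : ℝ) + 1) := by positivity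
    have hk1 : (1 : ℝ) / ((k : ℝ) + 1) ≤ 1 := by
      rw [div_le_one (by positivity)]
      linarith [(k.cast_nonneg : (0 : ℝ) ≤ k)]
    -- a deep layer
    obtain ⟨N, hN1, hN2, hN3⟩ : ∃ N, d N < a ∧ s' N < r₀ + 1 / ((k : ℝ) + 1) ∧
        ∫ x in {x : EuclideanSpace ℝ (Fin 3) | a < ‖x‖ ∧ ‖x‖ < b},
          ∑ i, ∑ j, |S N x i j - Q₀ x i j| < η := by
      have hrt : r₀ < r₀ + 1 / ((k : ℝ) + 1) := by linarith
      obtain ⟨N, ⟨h1, h2⟩, h3⟩ := (((hd.eventually_lt_const ha0).and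
        (hs'.eventually_lt_const hrt)).and
        ((hconv a b ha0 hab).eventually_lt_const hη)).exists
      exact ⟨N, h1, h2, h3⟩
    -- the two open sets and the `N`-th layer as a full stress
    have hWo : IsOpen {x : EuclideanSpace ℝ (Fin 3) | r₀ < ‖x‖} :=
      isOpen_lt continuous_const continuous_norm
    have hW'o : IsOpen {x : EuclideanSpace ℝ (Fin 3) | d N < ‖x‖} :=
      isOpen_lt continuous_const continuous_norm
    have htsW' : tsupport w ⊆ {x : EuclideanSpace ℝ (Fin 3) | d N < ‖x‖} := fun x hx =>
      lt_trans hN1 (hwa x hx)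
    set MN : EuclideanSpace ℝ (Fin 3) → Fin 3 → Fin 3 → ℝ := fun x i j =>
      S N x i j + if i = j then P N x else 0 with hMN
    have hMNs : ∀ i j, ContDiffOn ℝ 1 (fun x => MN x i j) {x | d N < ‖x‖} := by
      intro i j
      by_cases hij : i = j
      · simp only [hMN, hij, if_true]
        exact (hS N j j).add (hP N)
      · simp only [hMN, hij, if_false, add_zero]
        exact hS N i j
    have hMNdiv : ∀ x ∈ {x : EuclideanSpace ℝ (Fin 3) | d N < ‖x‖}, ∀ i,
        ∑ j, fderiv ℝ (fun y => MN y i j) x (EuclideanSpace.single j 1) = 0 := by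
      intro x hx i
      have hSd : ∀ i j, DifferentiableAt ℝ (fun y => S N y i j) x := fun i j =>
        ((hS N i j).contDiffAt (hW'o.mem_nhds hx)).differentiableAt one_ne_zero
      have hPd : DifferentiableAt ℝ (P N) x :=
        ((hP N).contDiffAt (hW'o.mem_nhds hx)).differentiableAt one_ne_zero
      have hterm : ∀ j, fderiv ℝ (fun y => MN y i j) x (EuclideanSpace.single j 1) =
          fderiv ℝ (fun y => S N y i j) x (EuclideanSpace.single j 1) +
            if i = j then fderiv ℝ (P N) x (EuclideanSpace.single j 1) else 0 := by
        intro j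
        by_cases hij : i = j
        · simp only [hMN, hij, if_true]
          rw [fderiv_fun_add (hSd j j) hPd]
          rfl
        · simp only [hMN, hij, if_false, add_zero]
      rw [Finset.sum_congr rfl fun j _ => hterm j, Finset.sum_add_distrib, Finset.sum_ite_eq,
        if_pos (Finset.mem_univ _)]
      exact hSP N x hx i
    -- the radial cut-off across the shell `s N < |x| < s' N` of the pure layer `N`
    obtain ⟨χ, ψ, hχs, hψs, hχψ, hψ01, hψc, hψs', -, hχsupp, hχgrad⟩ :=
      exists_radial_cutoff (hr₀.trans (hrs N)) (hss' N)
    have hχ1 : ContDiff ℝ 1 χ := hχs.of_le (by exact_mod_cast le_top)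
    -- the layer's pairing `GN = S_N : ∇w`; the isotropic part pairs to `P_N div w = 0`
    set GN : EuclideanSpace ℝ (Fin 3) → ℝ := fun x =>
      ∑ i, ∑ j, S N x i j * fderiv ℝ w x (EuclideanSpace.single j 1) i with hGN
    have hMN_pair : ∀ x, ∑ i, ∑ j, MN x i j * fderiv ℝ w x (EuclideanSpace.single j 1) i =
        GN x := by
      intro x
      simp only [hMN, hGN, add_mul, Finset.sum_add_distrib]
      rw [sum_sum_ite_mul_fderiv_apply_eq, hwdiv x, mul_zero, add_zero]
    have hGNint : Integrable GN := by
      refine integrable_finsetSum _ fun i _ => integrable_finsetSum _ fun j _ => ?_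
      have h := integrable_mul_of_tsupport_subset hW'o (hwcont i j) (hwcs i j)
        ((hwts i j).trans htsW') (hS N i j).continuousOn
      exact h.congr (Eventually.of_forall fun x => mul_comm _ _)
    have hGN0 : ∫ x, GN x = 0 := by
      have h := integral_sum_sum_mul_fderiv_apply_eq_zero hW'o hMNs hMNdiv hws hwc htsW'
      simpa only [hMN_pair] using h
    -- `∫ χ G = ∫ χ GN`: both stresses are divergence free and agree where `∇χ ≠ 0`
    have hχG : ∫ x, χ x * G x = ∫ x, χ x * GN x := by
      have h1 : ∀ x, χ x * G x =
          χ x * ∑ i, ∑ j, M x i j * fderiv ℝ w x (EuclideanSpace.single j 1) i := by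
        intro x
        by_cases hx : χ x = 0
        · simp [hx]
        · have hxW : r₀ < ‖x‖ := lt_trans (hrs N) (hχsupp (subset_tsupport χ (mem_support.2 hx)))
          congr 1
          simp only [hG]
          simp_rw [hMQ x hxW, add_mul, Finset.sum_add_distrib]
          rw [sum_sum_ite_mul_fderiv_apply_eq, hwdiv x, mul_zero, add_zero]
      have h2 : ∀ x, χ x * GN x =
          χ x * ∑ i, ∑ j, MN x i j * fderiv ℝ w x (EuclideanSpace.single j 1) i := fun x => by
        rw [hMN_pair]
      simp_rw [h1, h2]
      refine integral_mul_sum_sum_eq_of_fderiv_ne hWo hW'o hM (fun x hx => hMdiv x hx) hMNs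
        hMNdiv hχ1 hws hwc (fun x hx => lt_trans (hrs N) (hχsupp hx.1))
        (fun x hx => htsW' hx.2) fun x hx => ?_
      obtain ⟨hx1, hx2⟩ := hχgrad x hx
      funext i j
      exact hagree N x hx1 hx2 i j
    -- hence `∫ G = ∫ ψ (G - GN)`
    have hχeq : ∀ x, χ x = 1 - ψ x := fun x => by linarith [hχψ x]
    have hψG : Integrable (fun x => ψ x * G x) := by
      simpa only [smul_eq_mul] using
        hGint.locallyIntegrable.integrable_smul_left_of_hasCompactSupport hψs.continuous hψc
    have hψGN : Integrable (fun x => ψ x * GN x) := by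
      simpa only [smul_eq_mul] using
        hGNint.locallyIntegrable.integrable_smul_left_of_hasCompactSupport hψs.continuous hψc
    have hχGi : Integrable (fun x => χ x * G x) :=
      (hGint.sub hψG).congr (Eventually.of_forall fun x => by
        simp only [Pi.sub_apply, hχeq x]; ring)
    have hχGNi : Integrable (fun x => χ x * GN x) :=
      (hGNint.sub hψGN).congr (Eventually.of_forall fun x => by
        simp only [Pi.sub_apply, hχeq x]; ring)
    have hsplitG : ∫ x, G x = (∫ x, χ x * G x) + ∫ x, ψ x * G x := by
      rw [← integral_add hχGi hψG]
      exact integral_congr_ae (Eventually.of_forall fun x => by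
        simp only [← add_mul, hχψ x, one_mul])
    have hsplitGN : ∫ x, GN x = (∫ x, χ x * GN x) + ∫ x, ψ x * GN x := by
      rw [← integral_add hχGNi hψGN]
      exact integral_congr_ae (Eventually.of_forall fun x => by
        simp only [← add_mul, hχψ x, one_mul])
    have hfinal : ∫ x, G x = ∫ x, ψ x * (G x - GN x) := by
      have h : ∫ x, ψ x * (G x - GN x) = (∫ x, ψ x * G x) - ∫ x, ψ x * GN x := by
        rw [← integral_sub hψG hψGN]
        exact integral_congr_ae (Eventually.of_forall fun x => by ring)
      rw [h, hsplitG, hχG]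
      linarith [hsplitGN, hGN0]
    -- the bound `|ψ (G - GN)| ≤ K (1_T D + 1_A Σ|S_N - Q₀|)`
    set A : Set (EuclideanSpace ℝ (Fin 3)) := {x | a < ‖x‖ ∧ ‖x‖ < b} with hA
    have hAm : MeasurableSet A :=
      (measurableSet_lt measurable_const measurable_norm).inter
        (measurableSet_lt measurable_norm measurable_const)
    set HN : EuclideanSpace ℝ (Fin 3) → ℝ := fun x => ∑ i, ∑ j, |S N x i j - Q₀ x i j| with hHN
    have hHN0 : ∀ x, 0 ≤ HN x := fun x =>
      Finset.sum_nonneg fun i _ => Finset.sum_nonneg fun j _ => abs_nonneg _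
    have hHNint : IntegrableOn HN A := by
      refine IntegrableOn.mono_set ?_ (show A ⊆ {x : EuclideanSpace ℝ (Fin 3) | a ≤ ‖x‖ ∧ ‖x‖ ≤ b}
        from fun x hx => ⟨hx.1.le, hx.2.le⟩)
      refine integrable_finsetSum _ fun i _ => integrable_finsetSum _ fun j _ => ?_
      refine (Integrable.sub ?_ ?_).abs
      · exact ((hS N i j).continuousOn.mono fun x hx => lt_of_lt_of_le hN1 hx.1).integrableOn_compact
          (isCompact_shell a b)
      · exact (hQ₀ i j).integrableOn_compact_subset (shell_subset_ne_zero ha0 b)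
          (isCompact_shell a b)
    have hDk : IntegrableOn D (T k) := hDint.mono_set ((hTanti (Nat.zero_le k)).trans hT0)
    set bound : EuclideanSpace ℝ (Fin 3) → ℝ := fun x =>
      K * ((T k).indicator D x + A.indicator HN x) with hbound
    have hbound_int : Integrable bound :=
      ((hDk.integrable_indicator (hTm k)).add (hHNint.integrable_indicator hAm)).const_mul K
    have hpt : ∀ x, ‖ψ x * (G x - GN x)‖ ≤ bound x := by
      intro x
      have hb0 : 0 ≤ bound x :=
        mul_nonneg hK0 (add_nonneg (indicator_nonneg (fun y _ => hD0 y) x)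
          (indicator_nonneg (fun y _ => hHN0 y) x))
      by_cases hxw : x ∈ tsupport w
      swap
      · have h0 : G x - GN x = 0 := by simp [hG, hGN, hDw0 x hxw]
        rw [h0, mul_zero, norm_zero]
        exact hb0
      by_cases hψx : ψ x = 0
      · rw [hψx, zero_mul, norm_zero]
        exact hb0
      have hxs' : ‖x‖ < s' N := hψs' x hψx
      have hxA : x ∈ A := ⟨hwa x hxw, hwb x hxw⟩
      rw [Real.norm_eq_abs, abs_mul, abs_of_nonneg (hψ01 x).1]
      refine le_trans (mul_le_of_le_one_left (abs_nonneg _) (hψ01 x).2) ?_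
      have hdiff : G x - GN x =
          ∑ i, ∑ j, (Q x i j - S N x i j) * fderiv ℝ w x (EuclideanSpace.single j 1) i := by
        simp only [hG, hGN, ← Finset.sum_sub_distrib, sub_mul]
      rw [hdiff]
      calc |∑ i, ∑ j, (Q x i j - S N x i j) * fderiv ℝ w x (EuclideanSpace.single j 1) i|
          ≤ ∑ i, ∑ j, |(Q x i j - S N x i j) * fderiv ℝ w x (EuclideanSpace.single j 1) i| :=
            (Finset.abs_sum_le_sum_abs _ _).trans
              (Finset.sum_le_sum fun i _ => Finset.abs_sum_le_sum_abs _ _)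
        _ ≤ ∑ i, ∑ j, (|Q x i j - Q₀ x i j| + |S N x i j - Q₀ x i j|) * K := by
            refine Finset.sum_le_sum fun i _ => Finset.sum_le_sum fun j _ => ?_
            rw [abs_mul]
            refine mul_le_mul ?_ (hDw x i j) (abs_nonneg _) (by positivity)
            calc |Q x i j - S N x i j|
                = |(Q x i j - Q₀ x i j) - (S N x i j - Q₀ x i j)| := by ring_nf
              _ ≤ |Q x i j - Q₀ x i j| + |S N x i j - Q₀ x i j| := abs_sub _ _
        _ = K * (D x + HN x) := by
            simp only [hD, hHN, ← Finset.sum_mul, Finset.sum_add_distrib]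
            ring
        _ ≤ bound x := by
            simp only [hbound]
            refine mul_le_mul_of_nonneg_left ?_ hK0
            rw [indicator_of_mem hxA]
            refine add_le_add ?_ le_rfl
            by_cases hxr : r₀ ≤ ‖x‖
            · rw [indicator_of_mem (show x ∈ T k from ⟨hxr, lt_trans hxs' hN2⟩)]
            · have h0 : D x = 0 := by simp [hD, hQQ₀ x (not_le.1 hxr)]
              rw [h0]
              exact indicator_nonneg (fun y _ => hD0 y) x
    calc |∫ x, G x| = ‖∫ x, ψ x * (G x - GN x)‖ := by rw [hfinal, Real.norm_eq_abs]
      _ ≤ ∫ x, bound x := norm_integral_le_of_norm_le hbound_int (Eventually.of_forall hpt)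
      _ = K * ((∫ x in T k, D x) + ∫ x in A, HN x) := by
          simp only [hbound]
          rw [integral_const_mul, integral_add (hDk.integrable_indicator (hTm k))
            (hHNint.integrable_indicator hAm), integral_indicator (hTm k), integral_indicator hAm]
      _ ≤ K * (η + η) := by gcongr
  -- Step 3: conclusion
  refine abs_eq_zero.1 (le_antisymm (le_of_forall_pos_le_add fun ε hε => ?_) (abs_nonneg _))
  have hK1 : 0 < K + 1 := by linarith
  have h := hmain (ε / (2 * (K + 1))) (by positivity)
  calc |∫ x, G x| ≤ K * (ε / (2 * (K + 1)) + ε / (2 * (K + 1))) := h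
    _ = ε * (K / (K + 1)) := by field_simp; ring
    _ ≤ ε * 1 := by gcongr; exact (div_le_one hK1).2 (by linarith)
    _ = 0 + ε := by ring

/-- **Matching across the sphere, in the summit's format** (clause 10 of
`stub_freeSpaceSinkCompletion` given the ladder). Let `V` (the cone) and `U` (the glued
velocity) be measurable with `|V|², |U|² ∈ L¹_loc(ℝ³)`, `R` a stress with locally integrable
entries, `U = V` and `R = 0` on the open ball `|x| < r₀`; let `M` be a glued stress with `C¹`
entries, zero row-divergence and `M = U ⊗ U + R + p·Id` on `{r₀ < |x|}`; and let the layers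
`(S_N, P_N)` be as in `integral_sum_sum_mul_fderiv_apply_eq_zero_of_ladder` with
`S_N → V ⊗ V` in `L¹` on shells. Then `∫ (⟪U, Dw·U⟫ + Σᵢⱼ Rᵢⱼ (Dw eⱼ)ᵢ) = 0` for every smooth
divergence-free `w` compactly supported in `ℝ³ ∖ {0}`. [folklore] -/
theorem integral_eulerReynolds_eq_zero_of_ladder {r₀ : ℝ} (hr₀ : 0 < r₀)
    {V U : EuclideanSpace ℝ (Fin 3) → EuclideanSpace ℝ (Fin 3)}
    {R M : EuclideanSpace ℝ (Fin 3) → Fin 3 → Fin 3 → ℝ} {p : EuclideanSpace ℝ (Fin 3) → ℝ}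
    (hVm : AEStronglyMeasurable V volume)
    (hV2 : LocallyIntegrable (fun x => ‖V x‖ ^ 2) volume)
    (hUm : AEStronglyMeasurable U volume)
    (hU2 : LocallyIntegrable (fun x => ‖U x‖ ^ 2) volume)
    (hR : ∀ i j, LocallyIntegrable (fun x => R x i j) volume)
    (hUV : ∀ x, ‖x‖ < r₀ → U x = V x) (hR0 : ∀ x, ‖x‖ < r₀ → R x = 0)
    (hM : ∀ i j, ContDiffOn ℝ 1 (fun x => M x i j) {x | r₀ < ‖x‖})
    (hMdiv : ∀ x : EuclideanSpace ℝ (Fin 3), r₀ < ‖x‖ → ∀ i,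
      ∑ j, fderiv ℝ (fun y => M y i j) x (EuclideanSpace.single j 1) = 0)
    (hMR : ∀ x : EuclideanSpace ℝ (Fin 3), r₀ < ‖x‖ → ∀ i j,
      M x i j = U x i * U x j + R x i j + if i = j then p x else 0)
    {S : ℕ → EuclideanSpace ℝ (Fin 3) → Fin 3 → Fin 3 → ℝ} {P : ℕ → EuclideanSpace ℝ (Fin 3) → ℝ}
    {d s s' : ℕ → ℝ}
    (hS : ∀ N i j, ContDiffOn ℝ 1 (fun x => S N x i j) {x | d N < ‖x‖})
    (hP : ∀ N, ContDiffOn ℝ 1 (P N) {x | d N < ‖x‖})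
    (hSP : ∀ (N : ℕ) (x : EuclideanSpace ℝ (Fin 3)), d N < ‖x‖ → ∀ i,
      ∑ j, fderiv ℝ (fun y => S N y i j) x (EuclideanSpace.single j 1) +
        fderiv ℝ (P N) x (EuclideanSpace.single i 1) = 0)
    (hrs : ∀ N, r₀ < s N) (hss' : ∀ N, s N < s' N)
    (hd : Tendsto d atTop (𝓝 0)) (hs' : Tendsto s' atTop (𝓝 r₀))
    (hagree : ∀ (N : ℕ) (x : EuclideanSpace ℝ (Fin 3)), s N < ‖x‖ → ‖x‖ < s' N → ∀ i j,
      M x i j = S N x i j + if i = j then P N x else 0)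
    (hconv : ∀ a b : ℝ, 0 < a → a < b → Tendsto (fun N =>
      ∫ x in {x : EuclideanSpace ℝ (Fin 3) | a < ‖x‖ ∧ ‖x‖ < b},
        ∑ i, ∑ j, |S N x i j - V x i * V x j|) atTop (𝓝 0))
    {w : EuclideanSpace ℝ (Fin 3) → EuclideanSpace ℝ (Fin 3)}
    (hw : FunctionSpaces.IsTestFunctionOn
      ⟨{x : EuclideanSpace ℝ (Fin 3) | x ≠ 0}, isOpen_ne⟩ w)
    (hwdiv : ∀ x, VectorCalculus.divergence w x = 0) :
    ∫ x, (⟪U x, fderiv ℝ w x (U x)⟫ +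
      ∑ i, ∑ j, R x i j * fderiv ℝ w x (EuclideanSpace.single j 1) i) = 0 := by
  have key := integral_sum_sum_mul_fderiv_apply_eq_zero_of_ladder hr₀
    (Q := fun x i j => U x i * U x j + R x i j) (Q₀ := fun x i j => V x i * V x j) (M := M)
    (p := p) (fun i j => (MollifiedEulerCone.locallyIntegrable_apply_mul_apply hUm hU2 i j).add
      (hR i j))
    (fun i j => (MollifiedEulerCone.locallyIntegrable_apply_mul_apply hVm hV2 i j).locallyIntegrableOn
      _)
    (fun x hx => by funext i j; simp [hUV x hx, hR0 x hx]) hM hMdiv hMR hS hP hSP hrs hss' hd hs'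
    hagree hconv hw hwdiv
  rw [← key]
  refine integral_congr_ae (Eventually.of_forall fun x => ?_)
  simp only [add_mul, Finset.sum_add_distrib, MollifiedEulerCone.sum_sum_mul_mul_apply_single]

end EulerReynoldsLadder

end Literature.Analysis.FluidPDE

end
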